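import Mathlib.MeasureTheory.Integral.IntervalIntegral.FundThmCalculus
import Mathlib.Topology.Order.Compact

/-!
# RiemannHypothesis / UniversalFactor — the L²-pigeonhole of the energy-gap line

Route `RiemannHypothesis/UniversalFactor`, crux `NarrowKernelNoGo` (stmt-RiemannHypothesis-2576), line
`lorentz-filter-energy-gap` (crux idea, ideator 2; `Cruxes/NarrowKernelNoGo/SketchIdeator2.lean`).
Pure real analysis, sorry-free:

* `UniversalFactor.sq_integral_le_mul_integral_sq` — Cauchy–Schwarz `(∫_a^b g)² ≤ (b − a)∫_a^b g²`.
* `UniversalFactor.exists_window_forall_ne_zero` — the **L²-pigeonhole**: a `C¹` real function `R`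
  on `[T, 2T+1]` with `∫_T^{2T} R² ≥ cT` and `∫_T^{2T+1} R'² ≤ CT` does not vanish on some window
  `[t₁, t₁ + 2h] ⊆ [T, 2T+1]`, `t₁ ≤ 2T`, as soon as `4h²C < c` (`2h ≤ 1`). (Partition into
  windows of length `2h`; on a window with `∫R² > 4h²∫R'²` the maximum of `R²` beats `2h ∫ R'²`,
  and `|R(s) − R(t₀)|² ≤ 2h ∫ R'²` by Cauchy–Schwarz.) Applied to the weighted real trace
  `R_a(t) = Re F_a(2t)·w(t)` it turns a log-free energy ratio `∫R'²/∫R² = O_a(1)` into an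
  `F_a`-zero-free window of fixed length (assembly in `UniversalFactorNarrowAssembly.lean`).

Reference: crux idea card `lorentz-filter-energy-gap` (2026-08-16), §Mechanism.
-/

noncomputable section

namespace Summit.RiemannHypothesis.RiemannHypothesis.Theorems

open MeasureTheory Set Filter Topology intervalIntegral

/-! ## Cauchy–Schwarz on an interval -/

/-- Cauchy–Schwarz for a continuous real function on `[a, b]`:
`(∫_a^b g)² ≤ (b − a) ∫_a^b g²`. [folklore] -/
theorem UniversalFactor.sq_integral_le_mul_integral_sq {g : ℝ → ℝ} {a b : ℝ} (hab : a ≤ b)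
    (hg : ContinuousOn g (Icc a b)) :
    (∫ t in a..b, g t) ^ 2 ≤ (b - a) * ∫ t in a..b, g t ^ 2 := by
  rcases hab.eq_or_lt with rfl | hlt
  · simp
  have hL : 0 < b - a := sub_pos.2 hlt
  have hgi : IntervalIntegrable g volume a b := (hg.mono (by rw [uIcc_of_le hab])).intervalIntegrable
  have hg2 : ContinuousOn (fun t => g t ^ 2) (Icc a b) := hg.pow 2
  have hg2i : IntervalIntegrable (fun t => g t ^ 2) volume a b :=
    (hg2.mono (by rw [uIcc_of_le hab])).intervalIntegrable
  set S : ℝ := ∫ t in a..b, g t with hS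
  set Q : ℝ := ∫ t in a..b, g t ^ 2 with hQ
  set m : ℝ := S / (b - a) with hm
  -- `0 ≤ ∫ (g - m)² = Q - 2 m S + m² (b - a)`
  have hexp : ∫ t in a..b, (g t - m) ^ 2 = Q - 2 * m * S + m ^ 2 * (b - a) := by
    have h1 : ∀ t, (g t - m) ^ 2 = g t ^ 2 - 2 * m * g t + m ^ 2 := fun t => by ring
    simp_rw [h1]
    rw [intervalIntegral.integral_add (hg2i.sub (hgi.const_mul _)) (by simp),
      intervalIntegral.integral_sub hg2i (hgi.const_mul _), intervalIntegral.integral_const_mul,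
      intervalIntegral.integral_const]
    simp only [smul_eq_mul]
    ring
  have hnonneg : 0 ≤ ∫ t in a..b, (g t - m) ^ 2 :=
    intervalIntegral.integral_nonneg hab fun t _ => sq_nonneg _
  rw [hexp, hm] at hnonneg
  have key : 0 ≤ Q - S ^ 2 / (b - a) := by
    have : Q - 2 * (S / (b - a)) * S + (S / (b - a)) ^ 2 * (b - a) = Q - S ^ 2 / (b - a) := by
      field_simp
      ring
    linarith [this]
  have := sub_nonneg.1 key
  rwa [div_le_iff₀ hL, mul_comm] at this

/-! ## The L²-pigeonhole: a zero-free window from a log-free energy ratio -/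

/-- **L²-pigeonhole.** Let `R` be `C¹` on `[T, 2T+1]` (`R'` its derivative), `T > 0`, `0 < h`,
`2h ≤ 1`, with `cT ≤ ∫_T^{2T} R²`, `∫_T^{2T+1} R'² ≤ CT` and `4h²C < c`. Then `R` has no zero on
some window `[t₁, t₁ + 2h]` with `T ≤ t₁ ≤ 2T`. Proof: cut `[T, T + 2h⌈T/2h⌉]` into windows of
length `2h`; summing, some window `W` has `∫_W R² > 4h² ∫_W R'²`; at a maximum point `t₀` of
`R²` on `W`, `2h R(t₀)² ≥ ∫_W R² > 4h² ∫_W R'²`, while for `s ∈ W`,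
`(R(s) − R(t₀))² ≤ |s − t₀| |∫_{t₀}^{s} R'²| ≤ 2h ∫_W R'² < R(t₀)²`. [folklore] -/
theorem UniversalFactor.exists_window_forall_ne_zero {R R' : ℝ → ℝ} {T h c C : ℝ}
    (hT : 0 < T) (hh : 0 < h) (hh1 : 2 * h ≤ 1) (hc : 4 * h ^ 2 * C < c)
    (hderiv : ∀ t ∈ Icc T (2 * T + 1), HasDerivAt R (R' t) t)
    (hR' : ContinuousOn R' (Icc T (2 * T + 1)))
    (hlow : c * T ≤ ∫ t in T..2 * T, R t ^ 2)
    (hup : ∫ t in T..(2 * T + 1), R' t ^ 2 ≤ C * T) :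
    ∃ t₁ : ℝ, T ≤ t₁ ∧ t₁ ≤ 2 * T ∧ ∀ s ∈ Icc t₁ (t₁ + 2 * h), R s ≠ 0 := by
  -- continuity and integrability
  have hRc : ContinuousOn R (Icc T (2 * T + 1)) := fun t ht =>
    (hderiv t ht).continuousAt.continuousWithinAt
  have hR2c : ContinuousOn (fun t => R t ^ 2) (Icc T (2 * T + 1)) := hRc.pow 2
  have hR'2c : ContinuousOn (fun t => R' t ^ 2) (Icc T (2 * T + 1)) := hR'.pow 2
  have hint2 : ∀ {u v : ℝ}, T ≤ u → u ≤ v → v ≤ 2 * T + 1 →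
      IntervalIntegrable (fun t => R t ^ 2) volume u v := fun hu huv hv =>
    ((hR2c.mono (Icc_subset_Icc hu hv)).mono (by rw [uIcc_of_le huv])).intervalIntegrable
  have hint'2 : ∀ {u v : ℝ}, T ≤ u → u ≤ v → v ≤ 2 * T + 1 →
      IntervalIntegrable (fun t => R' t ^ 2) volume u v := fun hu huv hv =>
    ((hR'2c.mono (Icc_subset_Icc hu hv)).mono (by rw [uIcc_of_le huv])).intervalIntegrable
  -- the windows
  set M : ℕ := ⌈T / (2 * h)⌉₊ with hM
  have h2h : 0 < 2 * h := by positivity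
  have hMge : T / (2 * h) ≤ M := Nat.le_ceil _
  have hMlt : (M : ℝ) < T / (2 * h) + 1 := Nat.ceil_lt_add_one (by positivity)
  set α : ℕ → ℝ := fun j => T + 2 * h * j with hα
  have hα0 : α 0 = T := by simp [hα]
  have hαmono : ∀ {i j : ℕ}, i ≤ j → α i ≤ α j := fun {i j} hij => by
    simp only [hα]
    have : (i : ℝ) ≤ j := by exact_mod_cast hij
    nlinarith
  have hαT : ∀ j, T ≤ α j := fun j => by rw [← hα0]; exact hαmono (Nat.zero_le j)
  have hαM_ge : 2 * T ≤ α M := by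
    simp only [hα]
    have : T ≤ 2 * h * M := by
      rw [div_le_iff₀ h2h] at hMge; linarith
    linarith
  have hαM_le : α M ≤ 2 * T + 1 := by
    simp only [hα]
    have : 2 * h * (M : ℝ) < T + 2 * h := by
      have := mul_lt_mul_of_pos_left hMlt h2h
      rwa [mul_add, mul_one, mul_div_cancel₀ _ h2h.ne'] at this
    linarith
  have hαle : ∀ {j : ℕ}, j ≤ M → α j ≤ 2 * T + 1 := fun hj => (hαmono hj).trans hαM_le
  have hαsucc : ∀ j, α (j + 1) = α j + 2 * h := fun j => by simp only [hα]; push_cast; ring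
  -- sums of the window integrals
  set A : ℕ → ℝ := fun j => ∫ t in α j..α (j + 1), R t ^ 2 with hA
  set B : ℕ → ℝ := fun j => ∫ t in α j..α (j + 1), R' t ^ 2 with hB
  have hsumA : ∑ j ∈ Finset.range M, A j = ∫ t in α 0..α M, R t ^ 2 := by
    refine intervalIntegral.sum_integral_adjacent_intervals fun k hk => ?_
    exact hint2 (hαT k) (hαmono (Nat.le_succ k)) (hαle (Nat.succ_le_of_lt hk))
  have hsumB : ∑ j ∈ Finset.range M, B j = ∫ t in α 0..α M, R' t ^ 2 := by
    refine intervalIntegral.sum_integral_adjacent_intervals fun k hk => ?_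
    exact hint'2 (hαT k) (hαmono (Nat.le_succ k)) (hαle (Nat.succ_le_of_lt hk))
  have hsumA_ge : c * T ≤ ∑ j ∈ Finset.range M, A j := by
    rw [hsumA, hα0]
    have h2T : T ≤ 2 * T := by linarith
    calc c * T ≤ ∫ t in T..2 * T, R t ^ 2 := hlow
      _ ≤ ∫ t in T..α M, R t ^ 2 :=
          intervalIntegral.integral_mono_interval le_rfl h2T hαM_ge
            (Filter.Eventually.of_forall fun t => sq_nonneg _) (hint2 le_rfl (h2T.trans hαM_ge) hαM_le)
  have hsumB_le : ∑ j ∈ Finset.range M, B j ≤ C * T := by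
    rw [hsumB, hα0]
    have h1 : T ≤ 2 * T + 1 := by linarith
    calc ∫ t in T..α M, R' t ^ 2 ≤ ∫ t in T..(2 * T + 1), R' t ^ 2 :=
          intervalIntegral.integral_mono_interval le_rfl (hαT M) hαM_le
            (Filter.Eventually.of_forall fun t => sq_nonneg _) (hint'2 le_rfl h1 le_rfl)
      _ ≤ C * T := hup
  -- some window has `4h² B_j < A_j`
  obtain ⟨j, hjM, hj⟩ : ∃ j ∈ Finset.range M, 4 * h ^ 2 * B j < A j := by
    apply Finset.exists_lt_of_sum_lt
    rw [← Finset.mul_sum]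
    have hC : 4 * h ^ 2 * ∑ i ∈ Finset.range M, B i ≤ 4 * h ^ 2 * (C * T) :=
      mul_le_mul_of_nonneg_left hsumB_le (by positivity)
    have : 4 * h ^ 2 * (C * T) < c * T := by nlinarith
    linarith
  have hjM' : j < M := Finset.mem_range.1 hjM
  -- the window `[t₁, t₁ + 2h]`
  set t₁ : ℝ := α j with ht₁
  have ht₁T : T ≤ t₁ := hαT j
  have ht₁2h : t₁ + 2 * h = α (j + 1) := (hαsucc j).symm
  have ht₁top : t₁ + 2 * h ≤ 2 * T + 1 := by rw [ht₁2h]; exact hαle (Nat.succ_le_of_lt hjM')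
  have ht₁2T : t₁ ≤ 2 * T := by
    simp only [ht₁, hα]
    have hj1 : (j : ℝ) + 1 ≤ M := by exact_mod_cast Nat.succ_le_of_lt hjM'
    have : 2 * h * ((j : ℝ) + 1) < T + 2 * h := by
      have h1 : 2 * h * ((j : ℝ) + 1) ≤ 2 * h * M := mul_le_mul_of_nonneg_left hj1 h2h.le
      have h2 : 2 * h * (M : ℝ) < T + 2 * h := by
        have := mul_lt_mul_of_pos_left hMlt h2h
        rwa [mul_add, mul_one, mul_div_cancel₀ _ h2h.ne'] at this
      linarith
    nlinarith
  have hsub : Icc t₁ (t₁ + 2 * h) ⊆ Icc T (2 * T + 1) := Icc_subset_Icc ht₁T ht₁top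
  have hBj : B j = ∫ t in t₁..(t₁ + 2 * h), R' t ^ 2 := by simp only [hB, ht₁, hαsucc]
  have hAj : A j = ∫ t in t₁..(t₁ + 2 * h), R t ^ 2 := by simp only [hA, ht₁, hαsucc]
  have hBnonneg : 0 ≤ B j := by
    rw [hBj]; exact intervalIntegral.integral_nonneg (by linarith) fun t _ => sq_nonneg _
  -- a maximum point of `R²` on the window
  have hwc : ContinuousOn (fun t => R t ^ 2) (Icc t₁ (t₁ + 2 * h)) := hR2c.mono hsub
  obtain ⟨t₀, ht₀, hmax⟩ := (isCompact_Icc (a := t₁) (b := t₁ + 2 * h)).exists_isMaxOn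
    (nonempty_Icc.2 (by linarith)) hwc
  have hAle : A j ≤ 2 * h * R t₀ ^ 2 := by
    rw [hAj]
    have h1 : ∫ t in t₁..(t₁ + 2 * h), R t ^ 2 ≤ ∫ _ in t₁..(t₁ + 2 * h), R t₀ ^ 2 :=
      intervalIntegral.integral_mono_on (by linarith)
        (hint2 ht₁T (by linarith) ht₁top) (by simp) fun t ht => hmax ht
    rw [intervalIntegral.integral_const, smul_eq_mul] at h1
    linarith
  have hkey : 2 * h * B j < R t₀ ^ 2 := by nlinarith
  refine ⟨t₁, ht₁T, ht₁2T, fun s hs hs0 => ?_⟩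
  -- Cauchy–Schwarz between `t₀` and `s`
  have hCS : ∀ {u v : ℝ}, u ∈ Icc t₁ (t₁ + 2 * h) → v ∈ Icc t₁ (t₁ + 2 * h) → u ≤ v →
      (R v - R u) ^ 2 ≤ 2 * h * B j := by
    intro u v hu hv huv
    have huv_sub : Icc u v ⊆ Icc T (2 * T + 1) := (Icc_subset_Icc hu.1 hv.2).trans hsub
    have hFTC : ∫ t in u..v, R' t = R v - R u := by
      refine intervalIntegral.integral_eq_sub_of_hasDerivAt (fun t ht => hderiv t (huv_sub ?_)) ?_
      · rwa [uIcc_of_le huv] at ht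
      · exact ((hR'.mono huv_sub).mono (by rw [uIcc_of_le huv])).intervalIntegrable
    have h1 := UniversalFactor.sq_integral_le_mul_integral_sq huv (hR'.mono huv_sub)
    rw [hFTC] at h1
    have h2 : ∫ t in u..v, R' t ^ 2 ≤ B j := by
      rw [hBj]
      exact intervalIntegral.integral_mono_interval hu.1 huv hv.2
        (Filter.Eventually.of_forall fun t => sq_nonneg _) (hint'2 ht₁T (by linarith) ht₁top)
    have h3 : v - u ≤ 2 * h := by linarith [hu.1, hv.2]
    have h4 : 0 ≤ ∫ t in u..v, R' t ^ 2 := intervalIntegral.integral_nonneg huv fun t _ => sq_nonneg _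
    calc (R v - R u) ^ 2 ≤ (v - u) * ∫ t in u..v, R' t ^ 2 := h1
      _ ≤ 2 * h * B j := mul_le_mul h3 h2 h4 (by positivity)
  have hdiff : (R s - R t₀) ^ 2 ≤ 2 * h * B j := by
    rcases le_total t₀ s with h0s | hs0'
    · exact hCS ht₀ hs h0s
    · have := hCS hs ht₀ hs0'
      rwa [← neg_sub, neg_sq] at this
  rw [hs0, zero_sub, neg_sq] at hdiff
  linarith

end Summit.RiemannHypothesis.RiemannHypothesis.Theorems
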